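import Summits.Ventures.PercRepro.RankLevelSetRuleQThirteenCertDefsLo2

/-!
# PercRepro — THE PARTIAL PRODUCTS OF THE LOWER CERTIFICATE OF THE FAMILY `k = 13` (p4, gen 25; C-044; paper §13.7): the two identities
`N^h·na + D^h·nb = P^h` (`h = C, D`; the lower convergent, eighths of the short factor), each one `ring` with the short half-factor on the left.
No `sorry`; axioms standard.
-/

namespace PercRepro

set_option maxHeartbeats 6400000 in
set_option maxRecDepth 16384 in
/-- The partial product identity C of the lower certificate: `N_23^C·na + D_23^C·nb` in `(q, m)` — the short part
(28 + 29 monomials) on the left of each product. -/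
lemma thirteen_lower_prodC (q m : ℚ) :
    cfTwentyThreeN8C q m * naThirteen q m + cfTwentyThreeD8C q m * nbThirteen q m = pLowerThirteenC q m := by
  unfold cfTwentyThreeN8C cfTwentyThreeD8C naThirteen nbThirteen pLowerThirteenC; ring

set_option maxHeartbeats 6400000 in
set_option maxRecDepth 16384 in
/-- The partial product identity D of the lower certificate: `N_23^D·na + D_23^D·nb` in `(q, m)` — the short part
(28 + 30 monomials) on the left of each product. -/
lemma thirteen_lower_prodD (q m : ℚ) :
    cfTwentyThreeN8D q m * naThirteen q m + cfTwentyThreeD8D q m * nbThirteen q m = pLowerThirteenD q m := by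
  unfold cfTwentyThreeN8D cfTwentyThreeD8D naThirteen nbThirteen pLowerThirteenD; ring

end PercRepro
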